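import Mathlib
import HarnessLib
import Summits.NavierStokesRegularity.NavierStokesRegularity.Theorems.UnthreadedDoorNetFluxOscLeVorticity
import Summits.NavierStokesRegularity.NavierStokesRegularity.Theorems.UnthreadedDoorNetFluxSphericalExtremumLaplacian
import Literature.Analysis.FluidPDE.TaoEnstrophyLocalisation
import Summits.NavierStokesRegularity.NavierStokesRegularity.Theorems.UnthreadedDoorKinematicShadowPointSourceCalculus

/-!
# Route `UnthreadedDoor`, crux `PoloidalLiouville` (stmt-NavierStokesRegularity-1222), WALL W1 — crux idea «indicatrix-bound»,
# Λ-0b+c bridge, part (T2a): step (iv) — ZEROTH-ORDER SUP BOUNDS FROM SPHERE DATA ONLY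

Step (iv) of the M-Lean bridge Λ-0b+c (`IndicatrixLeHessian` ⇐ Polterovich–Sodin 2007 Thm 1.5; `Cruxes/PoloidalLiouville/IndicatrixSketch.lean`
v1.7.5, docstring of `IndicatrixLeHessian`), for a `C²` field `u` linked to a slice potential `f` by `curl u = ∇f × (x − x₀)`:

* ★ `curl_eq_zero_of_mem_sphArgmax` — at a maximiser `x⋆` of `f` on `S_r(x₀)` the gradient of `f` is radial (Lagrange,
  the tree's `NetFlux.fderiv_eq_inner_mul_radDeriv_of_mem_sphArgmax` and `KinematicShadow.PointSource.cross_self`), so `curl u x⋆ = ∇f(x⋆) × (x⋆ − x₀) = 0`;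
* ★ `norm_curl_le_of_vanish` — great-circle mean value INSIDE the sphere: if `curl u` vanishes at one point of `S_r(x₀)` and
  `‖D(curl u)‖ ≤ B` on `S_r(x₀)`, then `‖curl u‖ ≤ π r B` on `S_r(x₀)` (arc of length `≤ π r`, no ball data);
* ★ `norm_curl_le_on_sphere` — with `B = ‖curlCLM‖ · K` from `‖D²u‖ ≤ K` on the sphere (`norm_fderiv_curl_le`): `‖curl u‖ ≤ π r ‖curlCLM‖ K`;
* ★ `abs_sub_le_on_sphere` — the oscillation bound `|f x − f x'| ≤ π · (π r ‖curlCLM‖ K)` for `x, x' ∈ S_r(x₀)` (the tree's NF-0 arc bound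
  `NetFlux.sub_le_pi_mul_of_norm_cross_gradient_le`).

Frozen-time calculus at one sphere; nothing here is an NS statement; ⟨1222⟩ / W1 / NS regularity OPEN — NOT proved.
`--supports stmt-NavierStokesRegularity-1222 --as helper`.  [folklore]
-/

noncomputable section

-- the summit and its single sub-problem share the name (CONVENTIONS §1)
set_option linter.dupNamespace false

open Set Function Filter Topology InnerProductSpace
open scoped RealInnerProductSpace

namespace Summit.NavierStokesRegularity.NavierStokesRegularity.Theorems.PoloidalLiouville.Indicatrix

open Summit.NavierStokesRegularity.NavierStokesRegularity.Theorems.PoloidalLiouville.NetFlux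
  (E3 sphArgmax sphArgmax_subset_sphere ne_center_of_mem_sphere radDeriv fderiv_eq_inner_mul_radDeriv_of_mem_sphArgmax
   exists_greatCircle cross_cross_eq_neg_of_unit_orth norm_cross_of_unit_orth cross_add_smul_right
   sub_le_pi_mul_of_norm_cross_gradient_le)
open Literature.Analysis Literature.Analysis.FluidPDE

/-! ### (iv-a) The linked curl vanishes at a spherical maximiser of the slice potential -/

/-- ★ **At a spherical maximiser of the slice potential the linked curl vanishes**: for `f` differentiable at `x ∈ argmax_{S_r(x₀)} f`,
`r > 0`, `∇f(x)` is radial (Lagrange), hence `curl u x = ∇f(x) × (x − x₀) = 0`. [folklore] -/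
theorem curl_eq_zero_of_mem_sphArgmax {u : E3 → E3} {f : E3 → ℝ} {x₀ x : E3} {r : ℝ} (hr : 0 < r)
    (hf : DifferentiableAt ℝ f x) (hx : x ∈ sphArgmax f x₀ r)
    (hlink : curl u x = cross (gradient f x) (x - x₀)) : curl u x = 0 := by
  have hgrad : gradient f x = (radDeriv f x₀ x * r⁻¹) • (x - x₀) := by
    apply ext_inner_right ℝ
    intro w
    rw [LocalHelmholtz.inner_gradient_left_eq_fderiv, fderiv_eq_inner_mul_radDeriv_of_mem_sphArgmax hr hf hx w,
      real_inner_smul_left, real_inner_smul_right, real_inner_comm]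
    ring
  have hsm : cross ((radDeriv f x₀ x * r⁻¹) • (x - x₀)) (x - x₀) =
      (radDeriv f x₀ x * r⁻¹) • cross (x - x₀) (x - x₀) := by
    rw [← crossCLM_apply, map_smul, _root_.smul_apply, crossCLM_apply]
  rw [hlink, hgrad, hsm, KinematicShadow.PointSource.cross_self, smul_zero]

/-! ### (iv-b) Great-circle mean value inside the sphere -/

/-- ★ **Great-circle mean value bound inside a sphere**: let `w : ℝ³ → F` be differentiable with `‖Dw‖ ≤ B` on `S_r(x₀)` (`r > 0`) and
`w x⋆ = 0` at some `x⋆ ∈ S_r(x₀)`; then `‖w x‖ ≤ π · r · B` for every `x ∈ S_r(x₀)` (integrate `Dw` along the great circle from `x⋆` to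
`x`, of length `≤ π r`, which stays on the sphere). [folklore] -/
theorem norm_le_of_vanish_on_sphere {F : Type*} [NormedAddCommGroup F] [NormedSpace ℝ F]
    {w : E3 → F} {x₀ xs : E3} {r B : ℝ} (hr : 0 < r) (hw : ∀ x ∈ Metric.sphere x₀ r, DifferentiableAt ℝ w x)
    (hxs : xs ∈ Metric.sphere x₀ r) (h0 : w xs = 0) (hB : ∀ x ∈ Metric.sphere x₀ r, ‖fderiv ℝ w x‖ ≤ B)
    {x : E3} (hx : x ∈ Metric.sphere x₀ r) : ‖w x‖ ≤ Real.pi * r * B := by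
  rw [mem_sphere_iff_norm] at hxs hx
  obtain ⟨n, θ₀, hn1, hna, hθ₀, hb⟩ := exists_greatCircle (a := xs - x₀) (b := x - x₀) hr hxs hx
  have hB0 : 0 ≤ B := (norm_nonneg _).trans (hB xs (mem_sphere_iff_norm.2 hxs))
  -- the great circle through `xs` and `x`
  set γ : ℝ → E3 := fun θ => x₀ + (Real.cos θ • (xs - x₀) + Real.sin θ • cross n (xs - x₀)) with hγ_def
  have hγ0 : γ 0 = xs := by simp [hγ_def]
  have hγ1 : γ θ₀ = x := by rw [hγ_def]; simp only; rw [← hb]; abel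
  have hac : ⟪xs - x₀, cross n (xs - x₀)⟫ = 0 := by
    simp only [Tao2016.real_inner_fin3, cross_apply_zero, cross_apply_one, cross_apply_two]; ring
  have hnc : ⟪n, cross n (xs - x₀)⟫ = 0 := by
    simp only [Tao2016.real_inner_fin3, cross_apply_zero, cross_apply_one, cross_apply_two]; ring
  have hγr : ∀ θ, ‖γ θ - x₀‖ = r := by
    intro θ
    have hsq : ‖γ θ - x₀‖ ^ 2 = r ^ 2 := by
      rw [hγ_def]
      simp only [add_sub_cancel_left]
      rw [← real_inner_self_eq_norm_sq, inner_add_left, inner_add_right, inner_add_right, real_inner_smul_left,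
        real_inner_smul_left, real_inner_smul_left, real_inner_smul_left, real_inner_smul_right,
        real_inner_smul_right, real_inner_smul_right, real_inner_smul_right, real_inner_self_eq_norm_sq,
        real_inner_self_eq_norm_sq, norm_cross_of_unit_orth hn1 hna, hxs, hac,
        real_inner_comm (xs - x₀) (cross n (xs - x₀)), hac]
      linear_combination r ^ 2 * Real.cos_sq_add_sin_sq θ
    have h := Real.sqrt_sq (norm_nonneg (γ θ - x₀))
    rw [hsq, Real.sqrt_sq hr.le] at h
    exact h.symm
  have hγS : ∀ θ, γ θ ∈ Metric.sphere x₀ r := fun θ => mem_sphere_iff_norm.2 (hγr θ)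
  -- `γ' = n × (γ − x₀)`, of norm `r`
  have hγd : ∀ θ, HasDerivAt γ (cross n (γ θ - x₀)) θ := by
    intro θ
    have h := (((Real.hasDerivAt_cos θ).smul_const (xs - x₀)).add
      ((Real.hasDerivAt_sin θ).smul_const (cross n (xs - x₀)))).const_add x₀
    have e : cross n (γ θ - x₀) = -Real.sin θ • (xs - x₀) + Real.cos θ • cross n (xs - x₀) := by
      rw [hγ_def]
      simp only [add_sub_cancel_left]
      rw [cross_add_smul_right, cross_cross_eq_neg_of_unit_orth hn1 hna, smul_neg, ← neg_smul]
      abel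
    rw [e]
    exact h
  have hnγ : ∀ θ, ⟪n, γ θ - x₀⟫ = 0 := by
    intro θ
    rw [hγ_def]
    simp only [add_sub_cancel_left]
    rw [inner_add_right, real_inner_smul_right, real_inner_smul_right, hna, hnc, mul_zero, mul_zero, add_zero]
  have hγ'n : ∀ θ, ‖cross n (γ θ - x₀)‖ = r := fun θ => by rw [norm_cross_of_unit_orth hn1 (hnγ θ), hγr θ]
  -- `w ∘ γ` and the bound on its derivative
  have hgd : ∀ θ, HasDerivAt (fun θ => w (γ θ)) (fderiv ℝ w (γ θ) (cross n (γ θ - x₀))) θ := fun θ =>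
    (hw _ (hγS θ)).hasFDerivAt.comp_hasDerivAt θ (hγd θ)
  have hbound : ∀ θ, ‖fderiv ℝ w (γ θ) (cross n (γ θ - x₀))‖ ≤ B * r := fun θ =>
    calc ‖fderiv ℝ w (γ θ) (cross n (γ θ - x₀))‖ ≤ ‖fderiv ℝ w (γ θ)‖ * ‖cross n (γ θ - x₀)‖ :=
          ContinuousLinearMap.le_opNorm _ _
      _ ≤ B * r := by
          rw [hγ'n θ]
          exact mul_le_mul_of_nonneg_right (hB _ (hγS θ)) hr.le
  -- mean value inequality on `[0, θ₀]`
  have hmv := Convex.norm_image_sub_le_of_norm_hasDerivWithin_le (s := univ)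
    (f := fun θ => w (γ θ)) (fun θ _ => (hgd θ).hasDerivWithinAt) (fun θ _ => hbound θ) convex_univ
    (mem_univ 0) (mem_univ θ₀)
  rw [hγ0, hγ1, h0, sub_zero, sub_zero, Real.norm_eq_abs, abs_of_nonneg hθ₀.1] at hmv
  calc ‖w x‖ ≤ B * r * θ₀ := hmv
    _ ≤ B * r * Real.pi := mul_le_mul_of_nonneg_left hθ₀.2 (mul_nonneg hB0 hr.le)
    _ = Real.pi * r * B := by ring

/-- ★ **`sup_{S_r} ‖curl u‖ ≤ π r ‖curlCLM‖ K` from sphere data only**: for `u ∈ C²(ℝ³; ℝ³)` with `‖D²u‖ ≤ K` ON `S_r(x₀)` (`r > 0`) whose curl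
vanishes at one point `x⋆ ∈ S_r(x₀)` (e.g. a spherical maximiser of a linked slice potential, `curl_eq_zero_of_mem_sphArgmax`),
`‖curl u x‖ ≤ π · r · ‖curlCLM‖ · K` for all `x ∈ S_r(x₀)`. [folklore] -/
theorem norm_curl_le_on_sphere {u : E3 → E3} {x₀ xs : E3} {r K : ℝ} (hr : 0 < r) (hu : ContDiff ℝ 2 u)
    (hxs : xs ∈ Metric.sphere x₀ r) (h0 : curl u xs = 0)
    (hK : ∀ x ∈ Metric.sphere x₀ r, ‖iteratedFDeriv ℝ 2 u x‖ ≤ K)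
    {x : E3} (hx : x ∈ Metric.sphere x₀ r) : ‖curl u x‖ ≤ Real.pi * r * (‖curlCLM‖ * K) := by
  have hcd : ∀ y, DifferentiableAt ℝ (curl u) y := fun y => by
    rw [curl_eq_curlCLM_comp]
    exact curlCLM.differentiableAt.comp y
      ((hu.fderiv_right (m := 1) (by norm_num)).differentiable one_ne_zero).differentiableAt
  refine norm_le_of_vanish_on_sphere hr (fun y _ => hcd y) hxs h0 (fun y hy => ?_) hx
  exact (norm_fderiv_curl_le hu y).trans (mul_le_mul_of_nonneg_left (hK y hy) (norm_nonneg curlCLM))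

/-! ### (iv-c) The oscillation of the slice potential over the sphere -/

/-- ★ **Oscillation of the slice potential over `S_r(x₀)` from the Hessian of the field**: for `u ∈ C²`, `f ∈ C¹` off `x₀`, linked by
`curl u = ∇f × (x − x₀)`, with `‖D²u‖ ≤ K` on `S_r(x₀)` (`r > 0`) and a point `x⋆ ∈ S_r(x₀)` where `curl u` vanishes:
`|f x − f x'| ≤ π · (π r ‖curlCLM‖ K)` for all `x, x' ∈ S_r(x₀)` (NF-0's arc bound with the sup bound of `norm_curl_le_on_sphere`). [folklore] -/
theorem abs_sub_le_on_sphere {u : E3 → E3} {f : E3 → ℝ} {x₀ xs : E3} {r K : ℝ} (hr : 0 < r) (hu : ContDiff ℝ 2 u)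
    (hf : ContDiffOn ℝ 1 f ({x₀}ᶜ)) (hlink : ∀ x, curl u x = cross (gradient f x) (x - x₀))
    (hxs : xs ∈ Metric.sphere x₀ r) (h0 : curl u xs = 0)
    (hK : ∀ x ∈ Metric.sphere x₀ r, ‖iteratedFDeriv ℝ 2 u x‖ ≤ K)
    {x x' : E3} (hx : x ∈ Metric.sphere x₀ r) (hx' : x' ∈ Metric.sphere x₀ r) :
    |f x - f x'| ≤ Real.pi * (Real.pi * r * (‖curlCLM‖ * K)) := by
  have hK' : ∀ y ∈ Metric.sphere x₀ r, ‖cross (gradient f y) (y - x₀)‖ ≤ Real.pi * r * (‖curlCLM‖ * K) := fun y hy => by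
    rw [← hlink y]; exact norm_curl_le_on_sphere hr hu hxs h0 hK hy
  rw [abs_le]
  constructor
  · have h := sub_le_pi_mul_of_norm_cross_gradient_le hr hf hK' hx hx'
    linarith
  · exact sub_le_pi_mul_of_norm_cross_gradient_le hr hf hK' hx' hx

end Summit.NavierStokesRegularity.NavierStokesRegularity.Theorems.PoloidalLiouville.Indicatrix

end
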